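import Summits.HodgeConjecture.HodgeConjecture.Theorems.F0P3HilbertProjection
import Literature.NumberTheory.Automorphic.UnitaryGroupCotangentSpectralProjection
import Literature.NumberTheory.Automorphic.AutomorphicSpectrum
import HarnessLib

/-!
# Crux `H413`, line `F0_U3CohMultOne` — LETTER ADAPTERS: the filed letters (D), (E) ⇒ the binder texts of the S3/S4/S5 folds

Floor-0 programme P3 «U3-mult», seat F0P3-p02 (g0); crux item stmt-HodgeConjecture-24833 (`HCCMUnconditional.H413`); lead's order F0/P3 bus
2026-08-30T22:36:00Z.  HC_CM is proved only modulo the printed citations until rung 0 closes.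

The typer's letter file ★ `Literature/NumberTheory/Automorphic/UnitaryGroupCotangentSpectralProjection.lean` (p792838) states
(D) `holCotFormSpectralProjection` / `antiholCotFormSpectralProjection` in REPRESENTABLE form («the orthogonal projections onto `P` of the
coordinate classes of a (anti)holomorphic cotangent form are the coordinate classes of one of the same type») and (E) `cohIsotypicLine_hol` /
`cohIsotypicLine_antihol` with the adjectives `σ.IsIrreducible → σ.IsSmooth →`.  The folds carry (D) in DETECTION form («`P` not orthogonal to a
coordinate class of such a form ⇒ `P.IsHolCotangentAt` / `IsAntiholCotangentAt`», ★ `F0P3StubS5Fold.stubS5_of` :93–122, p03's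
`stubS3_of_letters`/`stubS4_of_letters`) and (E) with the extra binder `σ.IsAdmissible →` (p03).  This file gives the four one-directional
ADAPTERS, with the fold binders' texts VERBATIM as conclusions, so that the line's v1.4 composition is by δ:
* `detection_hol_of_spectralProjection`, `detection_antihol_of_spectralProjection` — representable ⇒ detection: if `⟪u, [Φ_j]⟫ ≠ 0` for some
  `u ∈ P` then `pr_P [Φ_j] ≠ 0`, so the representing form `Ψ` has a non-zero class, hence `Ψ ≠ 0`, and `P.ContainsForm Ψ` because its classes ARE
  projections onto `P`;
* `isotypicLine_hol_of_filed`, `isotypicLine_antihol_of_filed` — drop the unused admissibility hypothesis.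

References: [BorelJacquet1979] §4.6; [Borel1997] Thm. 2.13, §8.4; [BorelWallach2000] VI 4.11, VII 3.2; [Flath1979] §2.
-/

-- the mandated namespace repeats `HodgeConjecture.HodgeConjecture`, as in every `Theorems/*.lean` of this sub-problem
set_option linter.dupNamespace false

noncomputable section

open MeasureTheory NumberField
open scoped InnerProductSpace ENNReal ComplexOrder Matrix

namespace Summit.HodgeConjecture.HodgeConjecture.Cruxes.H413.F0P3LetterAdapters

open Literature.NumberTheory.Automorphic Literature.NumberTheory.Automorphic.UnitaryGroup
open Literature.NumberTheory.Automorphic.UnitaryGroup.CotangentForms (toQuotFun cmArchSection cmCompactFactor)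
open Summit.HodgeConjecture.HodgeConjecture.Cruxes.H413.F0P3HilbertProjection

section Generic

variable {F₀ E : Type} [Field F₀] [NumberField F₀] [Field E] [NumberField E] [Algebra F₀ E]
  {c : E ≃ₐ[F₀] E} {N : ℕ} {J : Matrix (Fin N) (Fin N) E}
  {μ : Measure (adelicGroupData F₀ E c N J).automorphicQuotient}
  [SMulInvariantMeasure (adelicGroupData F₀ E c N J).Adelic (adelicGroupData F₀ E c N J).automorphicQuotient μ]

/-- **Representable ⇒ detection, for any type `A` of forms**: if the projections onto `P` of the coordinate classes of `Φ` are the coordinate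
classes of `Ψ ∈ A`, and `P` is not orthogonal to some coordinate class of `Φ`, then `Ψ ≠ 0` and `P.ContainsForm Ψ`. [cite: BorelJacquet1979, §4.6] -/
theorem exists_ne_zero_containsForm_of_represented (P : DiscreteAutomorphicRep (adelicGroupData F₀ E c N J) μ)
    {A : Submodule ℂ ((adelicGroupData F₀ E c N J).Adelic → (Fin 2 → ℂ))} {Φ Ψ : (adelicGroupData F₀ E c N J).Adelic → (Fin 2 → ℂ)}
    (hΨ : Ψ ∈ A) (hΦ : ∀ j : Fin 2, MemLp (toQuotFun (adelicGroupData F₀ E c N J) fun g => Φ g j) 2 μ)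
    (hΨm : ∀ j : Fin 2, MemLp (toQuotFun (adelicGroupData F₀ E c N J) fun g => Ψ g j) 2 μ)
    (heq : ∀ j : Fin 2, P.space.toSubmodule.starProjection ((hΦ j).toLp _) = ((hΨm j).toLp _ : (adelicGroupData F₀ E c N J).L2 μ))
    (hu : ∃ (j : Fin 2), ∃ u ∈ P.space, ⟪(u : (adelicGroupData F₀ E c N J).L2 μ), (hΦ j).toLp⟫_ℂ ≠ 0) :
    ∃ Φ' ∈ A, Φ' ≠ 0 ∧ P.ContainsForm Φ' := by
  obtain ⟨j, hu⟩ := hu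
  refine ⟨Ψ, hΨ, ?_, fun j' => ⟨hΨm j', ?_⟩⟩
  · rintro rfl
    have h0 : ((hΨm j).toLp _ : (adelicGroupData F₀ E c N J).L2 μ) = 0 := MemLp.toLp_zero (hΨm j)
    have h1 := heq j
    rw [h0, Submodule.starProjection_apply] at h1
    exact orthogonalProjectionOnto_ne_zero P.space hu (by exact_mod_cast h1)
  · rw [← heq j']
    exact Submodule.starProjection_apply_mem _ _

end Generic

/-- **(D), holomorphic: representable ⇒ detection** — ★ `CotangentForms.holCotFormSpectralProjection` implies the DETECTION binder of the S3/S5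
folds (text = ★ `F0P3StubS5Fold.stubS5_of` binder `hTPhol`, verbatim). [cite: BorelJacquet1979, §4.6] [cite: Borel1997, Thm. 2.13 and §8.4] -/
theorem detection_hol_of_spectralProjection
    (hD : Literature.NumberTheory.Automorphic.UnitaryGroup.CotangentForms.holCotFormSpectralProjection) :
    ∀ (L : Type) [Field L] [NumberField L] [IsCMField L] (ι : L →+* ℂ) (H : Matrix (Fin 3) (Fin 3) L) (T : GL (Fin 3) ℂ)
    (hT : (T : Matrix (Fin 3) (Fin 3) ℂ)ᴴ * H.map ι * (T : Matrix (Fin 3) (Fin 3) ℂ) = Literature.Geometry.ComplexHyperbolic.BallModel.J),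
    (∀ τ' : L →+* ℂ, InfinitePlace.mk τ' ≠ InfinitePlace.mk ι → (H.map τ').PosDef) →
    2 ≤ Module.finrank ℚ ↥(maximalRealSubfield L) →
    ∀ (μ : Measure (adelicGroupData (↥(maximalRealSubfield L)) L (IsCMField.complexConj L) 3 H).automorphicQuotient)
    [(adelicGroupData (↥(maximalRealSubfield L)) L (IsCMField.complexConj L) 3 H).IsAutomorphicMeasure μ]
    (P : DiscreteAutomorphicRep (adelicGroupData (↥(maximalRealSubfield L)) L (IsCMField.complexConj L) 3 H) μ)
    (Φ : (adelicGroupData (↥(maximalRealSubfield L)) L (IsCMField.complexConj L) 3 H).Adelic → (Fin 2 → ℂ)),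
    Φ ∈ CotangentForms.holCotForms (↥(maximalRealSubfield L)) L (IsCMField.complexConj L) 3 H (cmArchSection L ι H T hT)
    (cmCompactFactor L ι H T hT) →
    ∀ (h : ∀ j : Fin 2, MemLp (toQuotFun (adelicGroupData (↥(maximalRealSubfield L)) L (IsCMField.complexConj L) 3 H)
    fun x => Φ x j) 2 μ),
    (∃ (j : Fin 2), ∃ u ∈ P.space,
    ⟪(u : (adelicGroupData (↥(maximalRealSubfield L)) L (IsCMField.complexConj L) 3 H).L2 μ), (h j).toLp⟫_ℂ ≠ 0) →
    P.IsHolCotangentAt (cmArchSection L ι H T hT) (cmCompactFactor L ι H T hT) := by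
  intro L _ _ _ ι H T hT hdef h2 μ _ P Φ hΦ h hu
  obtain ⟨Ψ, hΨ, hΨm, heq⟩ := hD L ι H T hT hdef h2 μ P Φ hΦ h
  exact exists_ne_zero_containsForm_of_represented P hΨ h hΨm heq hu

/-- **(D), antiholomorphic: representable ⇒ detection** (text = ★ `F0P3StubS5Fold.stubS5_of` binder `hTPantihol`, verbatim).
[cite: BorelJacquet1979, §4.6] [cite: Borel1997, Thm. 2.13 and §8.4] -/
theorem detection_antihol_of_spectralProjection
    (hD : Literature.NumberTheory.Automorphic.UnitaryGroup.CotangentForms.antiholCotFormSpectralProjection) :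
    ∀ (L : Type) [Field L] [NumberField L] [IsCMField L] (ι : L →+* ℂ) (H : Matrix (Fin 3) (Fin 3) L) (T : GL (Fin 3) ℂ)
    (hT : (T : Matrix (Fin 3) (Fin 3) ℂ)ᴴ * H.map ι * (T : Matrix (Fin 3) (Fin 3) ℂ) = Literature.Geometry.ComplexHyperbolic.BallModel.J),
    (∀ τ' : L →+* ℂ, InfinitePlace.mk τ' ≠ InfinitePlace.mk ι → (H.map τ').PosDef) →
    2 ≤ Module.finrank ℚ ↥(maximalRealSubfield L) →
    ∀ (μ : Measure (adelicGroupData (↥(maximalRealSubfield L)) L (IsCMField.complexConj L) 3 H).automorphicQuotient)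
    [(adelicGroupData (↥(maximalRealSubfield L)) L (IsCMField.complexConj L) 3 H).IsAutomorphicMeasure μ]
    (P : DiscreteAutomorphicRep (adelicGroupData (↥(maximalRealSubfield L)) L (IsCMField.complexConj L) 3 H) μ)
    (Φ : (adelicGroupData (↥(maximalRealSubfield L)) L (IsCMField.complexConj L) 3 H).Adelic → (Fin 2 → ℂ)),
    Φ ∈ (CotangentForms.holCotForms (↥(maximalRealSubfield L)) L (IsCMField.complexConj L) 3 H (cmArchSection L ι H T hT)
    (cmCompactFactor L ι H T hT)).map (CotangentForms.conjFun (↥(maximalRealSubfield L)) L (IsCMField.complexConj L) 3 H) →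
    ∀ (h : ∀ j : Fin 2, MemLp (toQuotFun (adelicGroupData (↥(maximalRealSubfield L)) L (IsCMField.complexConj L) 3 H)
    fun x => Φ x j) 2 μ),
    (∃ (j : Fin 2), ∃ u ∈ P.space,
    ⟪(u : (adelicGroupData (↥(maximalRealSubfield L)) L (IsCMField.complexConj L) 3 H).L2 μ), (h j).toLp⟫_ℂ ≠ 0) →
    P.IsAntiholCotangentAt (cmArchSection L ι H T hT) (cmCompactFactor L ι H T hT) := by
  intro L _ _ _ ι H T hT hdef h2 μ _ P Φ hΦ h hu
  obtain ⟨Ψ, hΨ, hΨm, heq⟩ := hD L ι H T hT hdef h2 μ P Φ hΦ h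
  exact exists_ne_zero_containsForm_of_represented P hΨ h hΨm heq hu

/-- **(E), holomorphic: filed ⇒ fold binder** — ★ `CotangentForms.cohIsotypicLine_hol` implies p03's binder `hEhol` of `stubS3_of_letters`
(text verbatim; the extra hypothesis `σ.IsAdmissible` is dropped). [cite: Flath1979, §2] [cite: BorelWallach2000, VI 4.11; VII 3.2] -/
theorem isotypicLine_hol_of_filed
    (hE : Literature.NumberTheory.Automorphic.UnitaryGroup.CotangentForms.cohIsotypicLine_hol) :
    ∀ (L : Type) [Field L] [NumberField L] [IsCMField L] (ι : L →+* ℂ) (H : Matrix (Fin 3) (Fin 3) L) (T : GL (Fin 3) ℂ)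
    (hT : (T : Matrix (Fin 3) (Fin 3) ℂ)ᴴ * H.map ι * (T : Matrix (Fin 3) (Fin 3) ℂ) = Literature.Geometry.ComplexHyperbolic.BallModel.J),
    (∀ τ' : L →+* ℂ, InfinitePlace.mk τ' ≠ InfinitePlace.mk ι → (H.map τ').PosDef) →
    2 ≤ Module.finrank ℚ ↥(maximalRealSubfield L) →
    ∀ (μ : Measure (adelicGroupData (↥(maximalRealSubfield L)) L (IsCMField.complexConj L) 3 H).automorphicQuotient)
    [(adelicGroupData (↥(maximalRealSubfield L)) L (IsCMField.complexConj L) 3 H).IsAutomorphicMeasure μ]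
    (W : Type) [AddCommGroup W] [Module ℂ W]
    (σ : Representation ℂ (finAdelic (↥(maximalRealSubfield L)) L (IsCMField.complexConj L) 3 H) W),
    σ.IsIrreducible → σ.IsSmooth → σ.IsAdmissible →
    ∀ P : DiscreteAutomorphicRep (adelicGroupData (↥(maximalRealSubfield L)) L (IsCMField.complexConj L) 3 H) μ,
    ∃ ψ₀ : W →ₗ[ℂ] ((adelicGroupData (↥(maximalRealSubfield L)) L (IsCMField.complexConj L) 3 H).Adelic → (Fin 2 → ℂ)),
    ∀ ψ : W →ₗ[ℂ] ((adelicGroupData (↥(maximalRealSubfield L)) L (IsCMField.complexConj L) 3 H).Adelic → (Fin 2 → ℂ)),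
    (∀ (g : finAdelic (↥(maximalRealSubfield L)) L (IsCMField.complexConj L) 3 H) (w : W),
    ψ (σ g w) = CotangentForms.rightRep (↥(maximalRealSubfield L)) L (IsCMField.complexConj L) 3 H g (ψ w)) →
    (∀ w : W, ψ w ∈ CotangentForms.holCotForms (↥(maximalRealSubfield L)) L (IsCMField.complexConj L) 3 H (cmArchSection L ι H T hT)
    (cmCompactFactor L ι H T hT) ∧ P.ContainsForm (ψ w)) →
    ∃ r : ℂ, ψ = r • ψ₀ :=
  fun L _ _ _ ι H T hT hdef h2 μ _ W _ _ σ hirr hsm _ P => hE L ι H T hT hdef h2 μ W σ hirr hsm P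

/-- **(E), antiholomorphic: filed ⇒ fold binder** — ★ `CotangentForms.cohIsotypicLine_antihol` implies p03's binder `hEantihol` of
`stubS4_of_letters` (text verbatim; admissibility dropped). [cite: Flath1979, §2] [cite: BorelWallach2000, VI 4.11; VII 2.10, 3.2] -/
theorem isotypicLine_antihol_of_filed
    (hE : Literature.NumberTheory.Automorphic.UnitaryGroup.CotangentForms.cohIsotypicLine_antihol) :
    ∀ (L : Type) [Field L] [NumberField L] [IsCMField L] (ι : L →+* ℂ) (H : Matrix (Fin 3) (Fin 3) L) (T : GL (Fin 3) ℂ)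
    (hT : (T : Matrix (Fin 3) (Fin 3) ℂ)ᴴ * H.map ι * (T : Matrix (Fin 3) (Fin 3) ℂ) = Literature.Geometry.ComplexHyperbolic.BallModel.J),
    (∀ τ' : L →+* ℂ, InfinitePlace.mk τ' ≠ InfinitePlace.mk ι → (H.map τ').PosDef) →
    2 ≤ Module.finrank ℚ ↥(maximalRealSubfield L) →
    ∀ (μ : Measure (adelicGroupData (↥(maximalRealSubfield L)) L (IsCMField.complexConj L) 3 H).automorphicQuotient)
    [(adelicGroupData (↥(maximalRealSubfield L)) L (IsCMField.complexConj L) 3 H).IsAutomorphicMeasure μ]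
    (W : Type) [AddCommGroup W] [Module ℂ W]
    (σ : Representation ℂ (finAdelic (↥(maximalRealSubfield L)) L (IsCMField.complexConj L) 3 H) W),
    σ.IsIrreducible → σ.IsSmooth → σ.IsAdmissible →
    ∀ P : DiscreteAutomorphicRep (adelicGroupData (↥(maximalRealSubfield L)) L (IsCMField.complexConj L) 3 H) μ,
    ∃ ψ₀ : W →ₗ[ℂ] ((adelicGroupData (↥(maximalRealSubfield L)) L (IsCMField.complexConj L) 3 H).Adelic → (Fin 2 → ℂ)),
    ∀ ψ : W →ₗ[ℂ] ((adelicGroupData (↥(maximalRealSubfield L)) L (IsCMField.complexConj L) 3 H).Adelic → (Fin 2 → ℂ)),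
    (∀ (g : finAdelic (↥(maximalRealSubfield L)) L (IsCMField.complexConj L) 3 H) (w : W),
    ψ (σ g w) = CotangentForms.rightRep (↥(maximalRealSubfield L)) L (IsCMField.complexConj L) 3 H g (ψ w)) →
    (∀ w : W, ψ w ∈ (CotangentForms.holCotForms (↥(maximalRealSubfield L)) L (IsCMField.complexConj L) 3 H (cmArchSection L ι H T hT)
    (cmCompactFactor L ι H T hT)).map (CotangentForms.conjFun (↥(maximalRealSubfield L)) L (IsCMField.complexConj L) 3 H) ∧
    P.ContainsForm (ψ w)) →
    ∃ r : ℂ, ψ = r • ψ₀ :=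
  fun L _ _ _ ι H T hT hdef h2 μ _ W _ _ σ hirr hsm _ P => hE L ι H T hT hdef h2 μ W σ hirr hsm P

end Summit.HodgeConjecture.HodgeConjecture.Cruxes.H413.F0P3LetterAdapters

end
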